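import Summits.KontsevichZagierPeriods.KontsevichZagierPeriods.Theorems.CobordismMoveZeroCombination
import Literature.NumberTheory.Transcendental.KZDominatedFamilyRelations
import Literature.NumberTheory.Transcendental.SemialgebraicLineDeriv
import Literature.NumberTheory.Transcendental.SemialgebraicVolume
import Literature.ModelTheory.ExponentialFields.SemialgebraicInterior
import Mathlib.MeasureTheory.Function.Jacobian

/-!
# Lemmas for `SignedSheetTransfer` (stmt-KontsevichZagierPeriods-5567, route CobordismMove)

The six registered stubs of the strategist line `split`
(`Cruxes/SignedSheetTransfer/Lines/split.lean`), all PROVED (no `sorry`), by name and signature: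

* `stub_jacobianSemialgebraic` — on an open set, the Jacobian `|det (fderiv ℝ Φ x)|` of a
  `ℚ`-semialgebraic differentiable map is a `ℚ`-semialgebraic function (partials by
  `IsSemialgebraicFunOn.fderiv_apply_single`, Leibniz by `IsSemialgebraicFunOn.matrix_det`);
* `stub_sheetShrink` — synchronised open semialgebraic shrink `V_k = interior σ_k ∖ ⋃_j ∂σ_j` of
  finitely many semialgebraic sheets, losing only a null set
  (`volume_frontier_eq_zero_of_isSemialgebraic`);
* `stub_singleSheetPush` — one zero-extended sheet term is an `IntegralRep` and differs from the
  restricted image representation by a relation (domain additivity with a zero piece + ONE instance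
  of rule (2), `KZ.changeOfVariablesRel`; integrability by Mathlib's
  `integrableOn_image_iff_integrableOn_abs_det_fderiv_smul`);
* `stub_imageNullRestrict` — restricting an image representation from `Φ σ` to `Φ V` (`σ ∖ V` null)
  is a relation (`addHaar_image_eq_zero_of_differentiableOn_of_addHaar_eq_zero`);
* `stub_countSemialgebraic` — a finite `ℤ`-combination of indicators of semialgebraic sets is a
  semialgebraic function;
* `stub_indicatorExtension` — `[R.domain, 1_T · R.integrand] − [T ∩ R.domain, R.integrand]` is a
  relation.

They are assembled into the crux in `Theorems/CobordismMoveSignedSheetTransfer.lean`.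
References: Kontsevich–Zagier, *Periods* (2001) §1.2; Bochnak–Coste–Roy (1998) §2.2, §2.8;
Basu–Pollack–Roy (2006) Prop. 2.83, 3.22.
-/

noncomputable section

open MeasureTheory Set
open Literature.NumberTheory.Transcendental
open Literature.ModelTheory.ExponentialFields (IsSemialgebraic isSemialgebraic_interior
  isSemialgebraic_closure)

namespace Summit.KontsevichZagierPeriods.CobordismMove.SignedSheetTransferSplit

open Summit.KontsevichZagierPeriods.KontsevichZagierPeriods.Theses.CobordismMove
open Summit.KontsevichZagierPeriods.CobordismMove

variable {n : ℕ}

/-! ## Helpers (proved) -/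

/-- Finite unions of `ℚ`-semialgebraic sets indexed by `Fin N` are semialgebraic. -/
theorem isSemialgebraic_iUnion {N : ℕ} {s : Fin N → Set (Fin n → ℝ)}
    (hs : ∀ k, IsSemialgebraic ℚ (s k)) : IsSemialgebraic ℚ (⋃ k, s k) := by
  have := Literature.ModelTheory.ExponentialFields.IsSemialgebraic.biUnion (k := ℚ) Finset.univ s
    fun k _ => hs k
  simpa using this

/-! ## The lemmas of piece X₁ (the registered stubs of line `split`, now proved) -/

/-- X₁ stub 1 (Jacobian of a semialgebraic map is semialgebraic): on an OPEN set `U`, if `Φ` is a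
`ℚ`-semialgebraic map, Fréchet-differentiable at every point of `U`, then `x ↦ |det (fderiv ℝ Φ x)|`
is a `ℚ`-semialgebraic function on `U` (entries `∂_j Φ_i` semialgebraic by
`IsSemialgebraicFunOn.fderiv_apply_single`, Basu–Pollack–Roy Prop. 3.22; determinant by Leibniz,
`IsSemialgebraicFunOn.matrix_det`; absolute value). -/
theorem stub_jacobianSemialgebraic :
    ∀ {n : ℕ} (U : Set (Fin n → ℝ)) (Φ : (Fin n → ℝ) → (Fin n → ℝ)), IsOpen U →
      IsSemialgebraicMapOn ℚ U Φ → (∀ x ∈ U, DifferentiableAt ℝ Φ x) →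
      IsSemialgebraicFunOn ℚ U (fun x => |(fderiv ℝ Φ x).det|) := by
  intro n U Φ hU hΦ hd
  classical
  have hUsa : IsSemialgebraic ℚ U := IsSemialgebraicMapOn.isSemialgebraic_holds hΦ
  have hcomp : ∀ i, IsSemialgebraicFunOn ℚ U (fun x => Φ x i) :=
    (isSemialgebraicMapOn_iff_forall_holds hUsa).1 hΦ
  have hdi : ∀ i, ∀ x ∈ U, DifferentiableAt ℝ (fun y => Φ y i) x :=
    fun i x hx => differentiableAt_pi.1 (hd x hx) i
  have hentry : ∀ i j, IsSemialgebraicFunOn ℚ U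
      (fun x => fderiv ℝ (fun y => Φ y i) x (Pi.single j 1)) :=
    fun i j => (hcomp i).fderiv_apply_single hU (hdi i) j
  have hM : IsSemialgebraicFunOn ℚ U (fun x => (LinearMap.toMatrix'
      ((fderiv ℝ Φ x : (Fin n → ℝ) →L[ℝ] (Fin n → ℝ)) : (Fin n → ℝ) →ₗ[ℝ] (Fin n → ℝ))).det) :=
    IsSemialgebraicFunOn.matrix_det hUsa fun i j => (hentry i j).congr fun x hx => by
      beta_reduce
      rw [LinearMap.toMatrix'_apply, ContinuousLinearMap.coe_coe,
        (hasFDerivAt_pi'.1 (hd x hx).hasFDerivAt i).fderiv]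
      all_goals rfl
  refine (hM.congr fun x _ => ?_).abs
  exact LinearMap.det_toMatrix' _

/-- X₁ stub 2 (synchronised open shrink of the sheets): finitely many `ℚ`-semialgebraic sheets
`σ_k` admit OPEN `ℚ`-semialgebraic `V_k ⊆ σ_k` with `⋃_k (σ_k ∖ V_k)` null and such that on
`⋃_k V_k` membership in `σ_j` and in `V_j` agree for every `j` (take `V_k = interior σ_k ∖ ⋃_j ∂σ_j`;
frontiers of semialgebraic sets are null, BCR §2.8). -/
theorem stub_sheetShrink :
    ∀ {n N : ℕ} (σ : Fin N → Set (Fin n → ℝ)), (∀ k, IsSemialgebraic ℚ (σ k)) →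
      ∃ V : Fin N → Set (Fin n → ℝ), (∀ k, IsOpen (V k)) ∧ (∀ k, IsSemialgebraic ℚ (V k)) ∧
        (∀ k, V k ⊆ σ k) ∧ volume (⋃ k, (σ k \ V k)) = 0 ∧
        (∀ x ∈ ⋃ k, V k, ∀ j, x ∈ σ j → x ∈ V j) := by
  intro n N σ hσ
  have hBc : IsClosed (⋃ j, frontier (σ j)) := isClosed_iUnion_of_finite fun j => isClosed_frontier
  have hBnull : volume (⋃ j, frontier (σ j)) = 0 :=
    measure_iUnion_null fun j => volume_frontier_eq_zero_of_isSemialgebraic (hσ j)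
  have hBsa : IsSemialgebraic ℚ (⋃ j, frontier (σ j)) :=
    isSemialgebraic_iUnion fun j => (isSemialgebraic_closure (hσ j)).diff (isSemialgebraic_interior (hσ j))
  have key : ∀ j x, x ∈ σ j → x ∉ (⋃ j, frontier (σ j)) → x ∈ interior (σ j) := by
    intro j x hxj hxB
    have hxf : x ∉ frontier (σ j) := fun h => hxB (mem_iUnion.2 ⟨j, h⟩)
    have : x ∈ closure (σ j) \ frontier (σ j) := ⟨subset_closure hxj, hxf⟩
    rwa [closure_sdiff_frontier] at this
  refine ⟨fun k => interior (σ k) \ ⋃ j, frontier (σ j), fun k => isOpen_interior.sdiff hBc,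
    fun k => (isSemialgebraic_interior (hσ k)).diff hBsa,
    fun k => sdiff_subset.trans interior_subset, ?_, ?_⟩
  · refine measure_mono_null (iUnion_subset fun k => ?_) hBnull
    intro x hx
    by_contra hxB
    exact hx.2 ⟨key k x hx.1 hxB, hxB⟩
  · intro x hx j hxj
    obtain ⟨k, hk⟩ := mem_iUnion.1 hx
    exact ⟨key j x hxj hk.2, hk.2⟩

/-- X₁ stub 3 (one sheet, zero-extended, is pushed forward by ONE change of variables): for
`ℚ`-semialgebraic `V ⊆ G`, a `ℚ`-semialgebraic map `Φ` on `V`, injective with derivative `Φ'` within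
`V`, `Φ '' V ⊆ ρ.domain`, and the sheet term `h = (ρ.integrand ∘ Φ) · |det Φ'|` `ℚ`-semialgebraic on
`V`: there are representations `R = [G, 1_V h]` and `S = [Φ '' V, ρ.integrand]` with `[R] − [S] ∈
KZ.relations` (`h` integrable on `V` by Mathlib's `integrableOn_image_iff_integrableOn_abs_det_fderiv_smul`;
`[G, 1_V h] = [V, h] + [G ∖ V, 0]` by rule (1); `[V, h] − [Φ V, ρ.integrand]` is rule (2)). -/
theorem stub_singleSheetPush :
    ∀ {n : ℕ} (G V : Set (Fin n → ℝ)) (Φ : (Fin n → ℝ) → (Fin n → ℝ))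
      (Φ' : (Fin n → ℝ) → ((Fin n → ℝ) →L[ℝ] (Fin n → ℝ))) (ρ : KZ.IntegralRep n),
      IsSemialgebraic ℚ G → IsSemialgebraic ℚ V → V ⊆ G → IsSemialgebraicMapOn ℚ V Φ →
      (∀ x ∈ V, HasFDerivWithinAt Φ (Φ' x) V x) → InjOn Φ V → Φ '' V ⊆ ρ.domain →
      IsSemialgebraicFunOn ℚ V (fun x => ρ.integrand (Φ x) * |(Φ' x).det|) →
      ∃ R S : KZ.IntegralRep n, R.domain = G ∧
        R.integrand = V.indicator (fun x => ρ.integrand (Φ x) * |(Φ' x).det|) ∧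
        S.domain = Φ '' V ∧ S.integrand = ρ.integrand ∧ KZ.of R - KZ.of S ∈ KZ.relations := by
  intro n G V Φ Φ' ρ hG hV hVG hΦ hder hinj himg hh
  classical
  have hVm : MeasurableSet V :=
    Literature.ModelTheory.ExponentialFields.IsSemialgebraic.measurableSet_holds hV
  have hEsa : IsSemialgebraic ℚ (Φ '' V) :=
    IsSemialgebraicMapOn.isSemialgebraic_image_holds hΦ Subset.rfl hV
  -- integrability of the sheet term on `V` (change of variables for integrability)
  have hint : IntegrableOn (fun x => ρ.integrand (Φ x) * |(Φ' x).det|) V := by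
    have := (integrableOn_image_iff_integrableOn_abs_det_fderiv_smul volume hVm hder hinj
      ρ.integrand).1 (ρ.integrableOn.mono_set himg)
    exact this.congr_fun (fun x _ => by beta_reduce; rw [smul_eq_mul, mul_comm]) hVm
  -- the zero-extended sheet term on `G`
  have hRsa : IsSemialgebraicFunOn ℚ G (V.indicator fun x => ρ.integrand (Φ x) * |(Φ' x).det|) := by
    have h0 : IsSemialgebraicFunOn ℚ (G \ V) (fun _ => ((0 : ℕ) : ℝ)) :=
      isSemialgebraicFunOn_natCast (hG.diff hV) 0
    have := IsSemialgebraicFunOn.union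
      (F := V.indicator fun x => ρ.integrand (Φ x) * |(Φ' x).det|) hh h0
      (fun x hx => by simp [indicator_of_mem hx]) (fun x hx => by simp [indicator_of_notMem hx.2])
    rwa [union_sdiff_cancel hVG] at this
  obtain ⟨R, hRd, hRi⟩ : ∃ R : KZ.IntegralRep n, R.domain = G ∧
      R.integrand = V.indicator (fun x => ρ.integrand (Φ x) * |(Φ' x).det|) :=
    ⟨⟨G, _, hG, hRsa, (hint.integrable_indicator hVm).integrableOn⟩, rfl, rfl⟩
  have hVR : V ⊆ R.domain := hRd ▸ hVG
  have hGVR : G \ V ⊆ R.domain := hRd ▸ sdiff_subset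
  -- rule (1a): `[R] = [R|V] + [R|G∖V]`, the second with zero integrand
  have hadd : KZ.of R - KZ.of (R.restrict V hV hVR) -
      KZ.of (R.restrict (G \ V) (hG.diff hV) hGVR) ∈ KZ.domainAddRel :=
    ⟨n, R, R.restrict V hV hVR, R.restrict (G \ V) (hG.diff hV) hGVR,
      by
        show R.domain = V ∪ (G \ V)
        rw [hRd, union_sdiff_cancel hVG],
      by
        show volume (V ∩ (G \ V)) = 0
        rw [inter_sdiff_self, measure_empty],
      fun _ _ => rfl, fun _ _ => rfl, rfl⟩
  have e2 : KZ.of (R.restrict (G \ V) (hG.diff hV) hGVR) ∈ KZ.relations :=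
    KZ.of_mem_relations_of_eqOn_zero _ fun x hx => by
      show R.integrand x = 0
      rw [hRi]
      exact indicator_of_notMem hx.2 _
  -- rule (2): `[R|V] − [ρ|Φ V]` is literally one change-of-variables instance
  have e1 : KZ.of (R.restrict V hV hVR) - KZ.of (ρ.restrict (Φ '' V) hEsa himg) ∈ KZ.relations :=
    KZ.changeOfVariablesRel_subset_relations ⟨n, R.restrict V hV hVR, ρ.restrict (Φ '' V) hEsa himg,
      Φ, Φ', hΦ, hder, hinj, rfl, fun x hx => by
        show R.integrand x = ρ.integrand (Φ x) * |(Φ' x).det|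
        rw [hRi, indicator_of_mem (show x ∈ V from hx)], rfl⟩
  refine ⟨R, ρ.restrict (Φ '' V) hEsa himg, hRd, hRi, rfl, rfl, ?_⟩
  have : KZ.of R - KZ.of (ρ.restrict (Φ '' V) hEsa himg) =
      (KZ.of R - KZ.of (R.restrict V hV hVR) - KZ.of (R.restrict (G \ V) (hG.diff hV) hGVR)) +
      KZ.of (R.restrict (G \ V) (hG.diff hV) hGVR) +
      (KZ.of (R.restrict V hV hVR) - KZ.of (ρ.restrict (Φ '' V) hEsa himg)) := by abel
  rw [this]
  exact add_mem (add_mem (KZ.domainAddRel_subset_relations hadd) e2) e1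

/-- X₁ stub 4 (dropping the image of a null piece of the sheet from the target is a relation): if
`V ⊆ σ` with `σ ∖ V` null, `Φ` differentiable within `σ`, `ρ.domain = Φ '' σ` and `S = [Φ '' V,
ρ.integrand]`, then `[ρ] − [S] ∈ KZ.relations` (`Φ '' σ ∖ Φ '' V ⊆ Φ '' (σ ∖ V)` is null by
`addHaar_image_eq_zero_of_differentiableOn_of_addHaar_eq_zero`; rule (1)). -/
theorem stub_imageNullRestrict :
    ∀ {n : ℕ} (σ V : Set (Fin n → ℝ)) (Φ : (Fin n → ℝ) → (Fin n → ℝ))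
      (Φ' : (Fin n → ℝ) → ((Fin n → ℝ) →L[ℝ] (Fin n → ℝ))) (ρ S : KZ.IntegralRep n),
      V ⊆ σ → volume (σ \ V) = 0 → (∀ x ∈ σ, HasFDerivWithinAt Φ (Φ' x) σ x) →
      ρ.domain = Φ '' σ → S.domain = Φ '' V → EqOn S.integrand ρ.integrand S.domain →
      KZ.of ρ - KZ.of S ∈ KZ.relations := by
  intro n σ V Φ Φ' ρ S hVσ hnull hder hρ hSd hSi
  have hEsa : IsSemialgebraic ℚ (Φ '' V) := hSd ▸ S.isSemialgebraic_domain
  have hEρ : Φ '' V ⊆ ρ.domain := hρ ▸ image_mono hVσ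
  have hvol : volume (ρ.domain \ Φ '' V) = 0 := by
    rw [hρ]
    have hsub : Φ '' σ \ Φ '' V ⊆ Φ '' (σ \ V) := fun y hy => by
      obtain ⟨⟨x, hx, rfl⟩, hy⟩ := hy
      exact ⟨x, ⟨hx, fun hxV => hy ⟨x, hxV, rfl⟩⟩, rfl⟩
    refine measure_mono_null hsub ?_
    exact addHaar_image_eq_zero_of_differentiableOn_of_addHaar_eq_zero volume
      (fun x hx => ((hder x hx.1).mono sdiff_subset).differentiableWithinAt) hnull
  have e1 := ρ.of_sub_of_restrict_mem_relations hEsa hEρ hvol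
  have e2 : KZ.of (ρ.restrict (Φ '' V) hEsa hEρ) - KZ.of S ∈ KZ.relations :=
    KZ.of_sub_of_mem_relations_of_eqOn hSd fun x hx => by
      have hxS : x ∈ S.domain := by rw [hSd]; exact hx
      exact (hSi hxS).symm
  have : KZ.of ρ - KZ.of S = (KZ.of ρ - KZ.of (ρ.restrict (Φ '' V) hEsa hEρ)) +
      (KZ.of (ρ.restrict (Φ '' V) hEsa hEρ) - KZ.of S) := by abel
  rw [this]
  exact add_mem e1 e2

/-! ## The lemmas of piece X₂ (registered stubs, now proved) -/

/-- X₂ stub 1 (integer indicator combinations are semialgebraic functions): for `ℚ`-semialgebraic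
`τ` and `T_k`, the function `y ↦ Σ_k c_k 1_{T_k}(y)` is `ℚ`-semialgebraic on `τ`. -/
theorem stub_countSemialgebraic :
    ∀ {n N : ℕ} (τ : Set (Fin n → ℝ)) (T : Fin N → Set (Fin n → ℝ)) (c : Fin N → ℤ),
      IsSemialgebraic ℚ τ → (∀ k, IsSemialgebraic ℚ (T k)) →
      IsSemialgebraicFunOn ℚ τ (fun y => ∑ k : Fin N, (c k : ℝ) * (T k).indicator (fun _ => (1 : ℝ)) y) := by
  intro n N τ T c hτ hT
  refine KZ.isSemialgebraicFunOn_finset_sum Finset.univ hτ fun k _ => ?_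
  have hind : IsSemialgebraicFunOn ℚ τ ((T k).indicator (fun _ => (1 : ℝ))) := by
    have h1 : IsSemialgebraicFunOn ℚ (τ ∩ T k) (fun _ => ((1 : ℕ) : ℝ)) :=
      isSemialgebraicFunOn_natCast (hτ.inter (hT k)) 1
    have h0 : IsSemialgebraicFunOn ℚ (τ \ T k) (fun _ => ((0 : ℕ) : ℝ)) :=
      isSemialgebraicFunOn_natCast (hτ.diff (hT k)) 0
    have := IsSemialgebraicFunOn.union (F := (T k).indicator fun _ => (1 : ℝ)) h1 h0
      (fun x hx => by simp [indicator_of_mem hx.2]) (fun x hx => by simp [indicator_of_notMem hx.2])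
    rwa [inter_union_sdiff] at this
  exact IsSemialgebraicFunOn.mul_holds (isSemialgebraicFunOn_const_intCast hτ (c k)) hind

/-- X₂ stub 2 (indicator extension is a relation): for a representation `R`, a `ℚ`-semialgebraic
`T` and `S = [T ∩ R.domain, R.integrand]`, there is `W = [R.domain, 1_T R.integrand]` with
`[W] − [S] ∈ KZ.relations` (rule (1): `W = S + [R.domain ∖ T, 0]`). -/
theorem stub_indicatorExtension :
    ∀ {n : ℕ} (R S : KZ.IntegralRep n) (T : Set (Fin n → ℝ)), IsSemialgebraic ℚ T →
      S.domain = T ∩ R.domain → EqOn S.integrand R.integrand S.domain →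
      ∃ W : KZ.IntegralRep n, W.domain = R.domain ∧ W.integrand = T.indicator R.integrand ∧
        KZ.of W - KZ.of S ∈ KZ.relations := by
  intro n R S T hT hSd hSi
  classical
  have hRsa := R.isSemialgebraic_domain
  have hTm : MeasurableSet T :=
    Literature.ModelTheory.ExponentialFields.IsSemialgebraic.measurableSet_holds hT
  have hWsa : IsSemialgebraicFunOn ℚ R.domain (T.indicator R.integrand) := by
    have h1 : IsSemialgebraicFunOn ℚ (R.domain ∩ T) R.integrand :=
      R.isSemialgebraicFunOn_integrand.mono inter_subset_left (hRsa.inter hT)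
    have h0 : IsSemialgebraicFunOn ℚ (R.domain \ T) (fun _ => ((0 : ℕ) : ℝ)) :=
      isSemialgebraicFunOn_natCast (hRsa.diff hT) 0
    have := IsSemialgebraicFunOn.union (F := T.indicator R.integrand) h1 h0
      (fun x hx => by simp [indicator_of_mem hx.2]) (fun x hx => by simp [indicator_of_notMem hx.2])
    rwa [inter_union_sdiff] at this
  obtain ⟨W, hWd, hWi⟩ : ∃ W : KZ.IntegralRep n, W.domain = R.domain ∧
      W.integrand = T.indicator R.integrand :=
    ⟨⟨R.domain, T.indicator R.integrand, hRsa, hWsa, R.integrableOn.indicator hTm⟩, rfl, rfl⟩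
  have hsub1 : T ∩ R.domain ⊆ W.domain := hWd ▸ inter_subset_right
  have hsub2 : R.domain \ T ⊆ W.domain := hWd ▸ sdiff_subset
  have hadd : KZ.of W - KZ.of (W.restrict (T ∩ R.domain) (hT.inter hRsa) hsub1) -
      KZ.of (W.restrict (R.domain \ T) (hRsa.diff hT) hsub2) ∈ KZ.domainAddRel :=
    ⟨n, W, W.restrict (T ∩ R.domain) (hT.inter hRsa) hsub1,
      W.restrict (R.domain \ T) (hRsa.diff hT) hsub2,
      by
        show W.domain = (T ∩ R.domain) ∪ (R.domain \ T)
        rw [hWd, inter_comm, inter_union_sdiff],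
      by
        show volume ((T ∩ R.domain) ∩ (R.domain \ T)) = 0
        rw [inter_comm T, inter_assoc, inter_sdiff_self, inter_empty, measure_empty],
      fun _ _ => rfl, fun _ _ => rfl, rfl⟩
  have e2 : KZ.of (W.restrict (R.domain \ T) (hRsa.diff hT) hsub2) ∈ KZ.relations :=
    KZ.of_mem_relations_of_eqOn_zero _ fun x hx => by
      show W.integrand x = 0
      rw [hWi]
      exact indicator_of_notMem hx.2 _
  have e1 : KZ.of (W.restrict (T ∩ R.domain) (hT.inter hRsa) hsub1) - KZ.of S ∈ KZ.relations :=
    KZ.of_sub_of_mem_relations_of_eqOn hSd fun x hx => by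
      show W.integrand x = S.integrand x
      have hxS : x ∈ S.domain := by rw [hSd]; exact hx
      rw [hWi, indicator_of_mem (show x ∈ T from hx.1)]
      exact (hSi hxS).symm
  refine ⟨W, hWd, hWi, ?_⟩
  have : KZ.of W - KZ.of S =
      (KZ.of W - KZ.of (W.restrict (T ∩ R.domain) (hT.inter hRsa) hsub1) -
        KZ.of (W.restrict (R.domain \ T) (hRsa.diff hT) hsub2)) +
      KZ.of (W.restrict (R.domain \ T) (hRsa.diff hT) hsub2) +
      (KZ.of (W.restrict (T ∩ R.domain) (hT.inter hRsa) hsub1) - KZ.of S) := by abel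
  rw [this]
  exact add_mem (add_mem (KZ.domainAddRel_subset_relations hadd) e2) e1

end Summit.KontsevichZagierPeriods.CobordismMove.SignedSheetTransferSplit
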